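import Mathlib

/-!
# Sums, products and intersections of ideals in `k[x₁, …, xₙ]` (Cox–Little–O'Shea, Ch. 4 §3)

Literature anchor for **D. Cox, J. Little, D. O'Shea, *Ideals, Varieties, and Algorithms*
(UTM, Springer), Chapter 4, §3 "Sums, Products, and Intersections of Ideals"** [bib:
CoxLittleOShea2007; held as corpus key
`book:cox2007-ideals-varieties-algorithms-introduction-computational-algebraic-geometr` (chunked
scan, isbn 9783319167206; the numbering below is that of the held text); statements quoted from
chunks p0189 (Def. 1, Prop. 2, Cor. 3, Thm. 4), p0190 (Def. 5, Prop. 6), p0191 (Thm. 7, Def. 8,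
Prop. 9), p0192–p0193 (Lemma 10, Thm. 11), p0194 (the worked example, Def. 12), p0195 (Prop. 13,
Prop. 14), p0196 (Thm. 15 and the remark following it, Prop. 16)], stated over Mathlib's
`MvPolynomial σ k` with **no new definitions** (Thm. 4, Thm. 7, Lemma 10, Thm. 11, Def. 12/Prop. 13,
Prop. 14, the remark after Thm. 15, and the section's two worked examples).

## What is formalised

* **Varieties of sums and products** (`k ⊆ K` fields, `K`-valued points, Mathlib's relative
  `MvPolynomial.zeroLocus K`): `V(I + J) = V(I) ∩ V(J)` (Thm. 4, also for arbitrary families and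
  for unions of generating sets, Cor. 3), `V(I·J) = V(I) ∪ V(J)` (Thm. 7) and
  `V(I·J) = V(I ∩ J)` (the remark following Thm. 15).
* **The auxiliary-variable description of the intersection** (any commutative ring `R` of
  coefficients, any index type `σ`; the extra variable `t` is `X none` in
  `MvPolynomial (Option σ) R` and `k[x] ⊆ k[x, t]` is `rename some`):
  Lemma 10 (i) (generators of `f(t)·I`), Lemma 10 (ii) (substituting a value for `t` lands in
  `I`; stated for every ring retraction of `rename some`, in particular every substitution
  `t ↦ a`), and **Theorem 11**
  `I ∩ J = (t·I + (1 - t)·J) ∩ k[x₁, …, xₙ]`, both for ideals and for generating sets (the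
  input of the *algorithm for computing intersections*), together with the membership form and
  the reading of `(…) ∩ k[x₁, …, xₙ]` as the preimage under `rename some`.
* **Intersections of principal ideals**: in any GCD domain `⟨a⟩ ∩ ⟨b⟩ = ⟨lcm(a, b)⟩`
  (Prop. 13; Mathlib's `Ideal.span_singleton_inf_span_singleton` assumes a Euclidean domain,
  which `k[x₁, …, xₙ]` is not for `n ≥ 2`), the definition-free characterisation of the
  generators of `⟨f⟩ ∩ ⟨g⟩` as the least common multiples of Def. 12 (valid in every
  commutative ring), principality of `⟨f⟩ ∩ ⟨g⟩` in every UFD and in `k[x₁, …, xₙ]`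
  (Prop. 13 (i)), and the ideal form `⟨gcd · lcm⟩ = ⟨f g⟩` of Prop. 14.
* **Worked examples**: for `I = J = ⟨x, y⟩ ⊆ k[x, y]` one has `I·J < I ∩ J` (the example
  preceding Lemma 10; the witness `x ∉ I·J` is detected in the dual numbers `k[ε]`), and for
  `I = ⟨x²y⟩`, `J = ⟨xy²⟩` the certificate `x²y² = y·(t·x²y) + x·((1 - t)·xy²) ∈ t·I + (1 - t)·J`
  of the algorithm together with `⟨x²y⟩ ∩ ⟨xy²⟩ = ⟨x²y²⟩ = ⟨lcm(x²y, xy²)⟩` (the example following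
  Thm. 11 and Def. 12).

## Census (what is deliberately *not* restated)

Mathlib already provides, by name: `Ideal.span_union` (Cor. 3: `⟨f⟩ + ⟨g⟩ = ⟨f, g⟩`),
`Ideal.span_mul_span'` (Prop. 6: generators of `I·J`), `Ideal.mul_le_inf` (`IJ ⊆ I ∩ J`),
`Ideal.radical_inf` (Prop. 16: `√(I ∩ J) = √I ∩ √J`), `gcd_mul_lcm` (Prop. 14 up to units),
`lcm_dvd_iff`, `MvPolynomial.uniqueFactorizationMonoid`, `UniqueFactorizationMonoid.toGCDMonoid`
and the relative zero locus `MvPolynomial.zeroLocus` with `zeroLocus_span`, `zeroLocus_anti_mono`.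
In this tree, `Literature.RingTheory.MvPolynomial.ClosureTheorem.zeroLocus_inf` is Thm. 15
(`V(I ∩ J) = V(I) ∪ V(J)`) and `Literature.RingTheory.MvPolynomial.EliminationTheorem.elimIdeal`
is the elimination ideal through which Thm. 11 becomes an algorithm (Ch. 3 §1 Thm. 2); neither file
is imported here, so that this anchor depends on Mathlib only.
-/

open MvPolynomial

namespace Literature.RingTheory.MvPolynomial.IdealIntersection

/-! ### Varieties of sums and products (Thm. 4, Cor. 3, Thm. 7, remark after Thm. 15) -/

section Varieties

variable {σ : Type*} {k : Type*} [Field k] {K : Type*} [Field K] [Algebra k K]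

/-- **Thm. 4**: `V(I + J) = V(I) ∩ V(J)` on `K`-points.
[cite: CoxLittleOShea2007, Ch.4 §3 Thm. 4] -/
theorem zeroLocus_sup_eq_inter (I J : Ideal (MvPolynomial σ k)) :
    zeroLocus K (I ⊔ J) = zeroLocus K I ∩ zeroLocus K J := by
  ext x
  simp only [mem_zeroLocus_iff, Set.mem_inter_iff]
  refine ⟨fun h => ⟨fun p hp => h p (Ideal.mem_sup_left hp), fun p hp => h p (Ideal.mem_sup_right hp)⟩,
    fun h p hp => ?_⟩
  obtain ⟨a, ha, b, hb, rfl⟩ := Submodule.mem_sup.mp hp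
  rw [map_add, h.1 a ha, h.2 b hb, add_zero]

/-- **Thm. 4** for an arbitrary family of ideals: `V(Σᵢ Iᵢ) = ⋂ᵢ V(Iᵢ)`.
[cite: CoxLittleOShea2007, Ch.4 §3 Thm. 4] -/
theorem zeroLocus_iSup_eq_iInter {ι : Sort*} (I : ι → Ideal (MvPolynomial σ k)) :
    zeroLocus K (⨆ i, I i) = ⋂ i, zeroLocus K (I i) := by
  apply le_antisymm
  · exact Set.subset_iInter fun i => zeroLocus_anti_mono (le_iSup I i)
  · intro x hx p hp
    rw [Set.mem_iInter] at hx
    induction hp using Submodule.iSup_induction' with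
    | mem i q hq => exact hx i q hq
    | zero => simp
    | add a b _ _ ha hb => rw [map_add, ha, hb, add_zero]

/-- **Cor. 3 with Thm. 4**: `V(⟨F ∪ G⟩) = V(⟨F⟩) ∩ V(⟨G⟩)` — the variety of the ideal generated by
the union of two generating sets. [cite: CoxLittleOShea2007, Ch.4 §3 Cor. 3, Thm. 4] -/
theorem zeroLocus_span_union (F G : Set (MvPolynomial σ k)) :
    zeroLocus K (Ideal.span (F ∪ G)) = zeroLocus K (Ideal.span F) ∩ zeroLocus K (Ideal.span G) := by
  rw [Ideal.span_union, zeroLocus_sup_eq_inter]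

/-- **Thm. 7**: `V(I·J) = V(I) ∪ V(J)` on `K`-points (`K` a field).
[cite: CoxLittleOShea2007, Ch.4 §3 Thm. 7] -/
theorem zeroLocus_mul_eq_union (I J : Ideal (MvPolynomial σ k)) :
    zeroLocus K (I * J) = zeroLocus K I ∪ zeroLocus K J := by
  ext x
  simp only [mem_zeroLocus_iff, Set.mem_union]
  refine ⟨fun h => ?_, fun h r hr => ?_⟩
  · by_contra hx
    push Not at hx
    obtain ⟨⟨p, hp, hp0⟩, ⟨q, hq, hq0⟩⟩ := hx
    exact mul_ne_zero hp0 hq0 (by rw [← map_mul]; exact h _ (Ideal.mul_mem_mul hp hq))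
  · rcases h with hI | hJ
    · exact Submodule.mul_induction_on hr (fun p hp q _ => by rw [map_mul, hI p hp, zero_mul])
        fun a b ha hb => by rw [map_add, ha, hb, add_zero]
    · exact Submodule.mul_induction_on hr (fun p _ q hq => by rw [map_mul, hJ q hq, mul_zero])
        fun a b ha hb => by rw [map_add, ha, hb, add_zero]

/-- **Remark after Thm. 15**: the product and the intersection cut out the same variety,
`V(I·J) = V(I ∩ J)`. [cite: CoxLittleOShea2007, Ch.4 §3 Thm. 15 (proof and remark)] -/
theorem zeroLocus_mul_eq_zeroLocus_inf (I J : Ideal (MvPolynomial σ k)) :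
    zeroLocus K (I * J) = zeroLocus K (I ⊓ J) := by
  refine le_antisymm ?_ (zeroLocus_anti_mono Ideal.mul_le_inf)
  rw [zeroLocus_mul_eq_union]
  rintro x (h | h)
  · exact zeroLocus_anti_mono inf_le_left h
  · exact zeroLocus_anti_mono inf_le_right h

end Varieties

/-! ### The auxiliary variable `t` (Lemma 10, Thm. 11)

Throughout, `t := X none : MvPolynomial (Option σ) R` is the extra variable and
`rename some : MvPolynomial σ R →ₐ[R] MvPolynomial (Option σ) R` is the inclusion
`R[x] ⊆ R[x, t]`; CLO's `f(t)·I` is `Ideal.span {f(t)} * I.map (rename some)` and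
`(…) ∩ k[x₁, …, xₙ]` is `Ideal.comap (rename some)`. -/

section AuxVariable

variable {σ : Type*} {R : Type*} [CommRing R]

/-- **Lemma 10 (i)**: if `I = ⟨F⟩`, then `q·I ⊆ R[x, t]` is generated by the products `q · p`,
`p ∈ F` (stated for any `q ∈ R[x, t]`, in particular `q = f(t)`).
[cite: CoxLittleOShea2007, Ch.4 §3 Lemma 10 (i)] -/
theorem auxVar_span_singleton_mul_map_span (q : MvPolynomial (Option σ) R)
    (F : Set (MvPolynomial σ R)) :
    Ideal.span {q} * (Ideal.span F).map (rename (some : σ → Option σ)) =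
      Ideal.span ((fun p => q * rename some p) '' F) := by
  rw [Ideal.map_span, Ideal.span_mul_span', Set.singleton_mul, Set.image_image]

/-- **Lemma 10 (ii)**: if `g ∈ q·I` then substituting a value for `t` gives an element of `I`;
stated for every ring retraction `φ` of the inclusion `rename some` (every `R[x]`-algebra
substitution `t ↦ a(x)`, in particular `t ↦ a ∈ R`).
[cite: CoxLittleOShea2007, Ch.4 §3 Lemma 10 (ii)] -/
theorem auxVar_subst_mem_of_mem_span_singleton_mul
    (φ : MvPolynomial (Option σ) R →+* MvPolynomial σ R) (hφ : ∀ p, φ (rename some p) = p)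
    (q : MvPolynomial (Option σ) R) {I : Ideal (MvPolynomial σ R)} {g : MvPolynomial (Option σ) R}
    (hg : g ∈ Ideal.span {q} * I.map (rename (some : σ → Option σ))) : φ g ∈ I := by
  have hle : (Ideal.span {q} * I.map (rename (some : σ → Option σ))).map φ ≤ I := by
    rw [Ideal.map_mul]
    refine Ideal.mul_le_left.trans (Ideal.map_le_iff_le_comap.2 (Ideal.map_le_iff_le_comap.2 ?_))
    intro p hp
    simpa only [Ideal.mem_comap, hφ p] using hp
  exact hle (Ideal.mem_map_of_mem φ hg)

/-- The substitution `t ↦ a`, `xᵢ ↦ xᵢ` (for any `a ∈ R[x]`) is a retraction of `rename some`.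
[folklore] -/
private theorem aeval_elim_rename (a p : MvPolynomial σ R) :
    (aeval fun o : Option σ => o.elim a X : MvPolynomial (Option σ) R →ₐ[R] MvPolynomial σ R).toRingHom
      (rename (some : σ → Option σ) p) = p := by
  change aeval (fun o : Option σ => o.elim a X) (rename (some : σ → Option σ) p) = p
  rw [aeval_rename, show ((fun o : Option σ => o.elim a X) ∘ (some : σ → Option σ)) = X from rfl,
    aeval_X_left_apply]

/-- The substitution step in the proof of Thm. 11: a retraction `φ` of `rename some` killing `q'`
maps `q·I + q'·J` into `I`. [folklore] -/
private theorem mem_of_rename_mem_sup (φ : MvPolynomial (Option σ) R →+* MvPolynomial σ R)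
    (hφ : ∀ p, φ (rename some p) = p) {q q' : MvPolynomial (Option σ) R} (hq' : φ q' = 0)
    {I J : Ideal (MvPolynomial σ R)} {f : MvPolynomial σ R}
    (hf : rename (some : σ → Option σ) f ∈
      Ideal.span {q} * I.map (rename (some : σ → Option σ)) ⊔
        Ideal.span {q'} * J.map (rename (some : σ → Option σ))) :
    f ∈ I := by
  have hle : (Ideal.span {q} * I.map (rename (some : σ → Option σ)) ⊔
      Ideal.span {q'} * J.map (rename (some : σ → Option σ))).map φ ≤ I := by
    rw [Ideal.map_sup, sup_le_iff, Ideal.map_mul, Ideal.map_mul]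
    constructor
    · refine Ideal.mul_le_left.trans (Ideal.map_le_iff_le_comap.2 (Ideal.map_le_iff_le_comap.2 ?_))
      intro p hp
      simpa only [Ideal.mem_comap, hφ p] using hp
    · rw [Ideal.map_span, Set.image_singleton, hq', Ideal.span_singleton_eq_bot.2 rfl, Ideal.bot_mul]
      exact bot_le
  have h := hle (Ideal.mem_map_of_mem φ hf)
  rwa [hφ] at h

/-- **Thm. 11**: `I ∩ J = (t·I + (1 - t)·J) ∩ k[x₁, …, xₙ]`, for ideals of `R[x_σ]` over any
commutative ring `R` and any index type `σ`.
[cite: CoxLittleOShea2007, Ch.4 §3 Thm. 11] -/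
theorem auxVar_inf_eq_comap (I J : Ideal (MvPolynomial σ R)) :
    I ⊓ J = (Ideal.span {X none} * I.map (rename (some : σ → Option σ)) ⊔
      Ideal.span {1 - X none} * J.map (rename (some : σ → Option σ))).comap
        (rename (some : σ → Option σ) : MvPolynomial σ R →ₐ[R] MvPolynomial (Option σ) R) := by
  apply le_antisymm
  · rintro f ⟨hfI, hfJ⟩
    rw [Ideal.mem_comap]
    have h1 : rename (some : σ → Option σ) f =
        X none * rename (some : σ → Option σ) f + (1 - X none) * rename (some : σ → Option σ) f := by
      ring
    rw [h1]
    exact Submodule.add_mem_sup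
      (Ideal.mul_mem_mul (Ideal.mem_span_singleton_self _) (Ideal.mem_map_of_mem _ hfI))
      (Ideal.mul_mem_mul (Ideal.mem_span_singleton_self _) (Ideal.mem_map_of_mem _ hfJ))
  · intro f hf
    rw [Ideal.mem_comap] at hf
    -- substitute `t ↦ 1` (kills `(1 - t)·J`, lands in `I`) and `t ↦ 0` (kills `t·I`, lands in `J`)
    have hf' : rename (some : σ → Option σ) f ∈
        Ideal.span {1 - X none} * J.map (rename (some : σ → Option σ)) ⊔
          Ideal.span {X none} * I.map (rename (some : σ → Option σ)) := by
      rwa [sup_comm] at hf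
    exact ⟨mem_of_rename_mem_sup _ (aeval_elim_rename 1) (by simp) hf,
      mem_of_rename_mem_sup _ (aeval_elim_rename 0) (by simp) hf'⟩

/-- **Thm. 11**, membership form: `f ∈ I ∩ J` iff `f`, read in `R[x, t]`, lies in
`t·I + (1 - t)·J`. [cite: CoxLittleOShea2007, Ch.4 §3 Thm. 11] -/
theorem auxVar_mem_inf_iff (I J : Ideal (MvPolynomial σ R)) (f : MvPolynomial σ R) :
    f ∈ I ⊓ J ↔ rename (some : σ → Option σ) f ∈
      Ideal.span {X none} * I.map (rename (some : σ → Option σ)) ⊔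
        Ideal.span {1 - X none} * J.map (rename (some : σ → Option σ)) := by
  rw [auxVar_inf_eq_comap, Ideal.mem_comap]

/-- **Thm. 11 for generating sets** (the input of the *algorithm for computing intersections*):
if `I = ⟨F⟩` and `J = ⟨G⟩`, then `I ∩ J = ⟨t·F, (1 - t)·G⟩ ∩ k[x₁, …, xₙ]`; with Ch. 3 §1 Thm. 2 a
lex Gröbner basis of the right-hand ideal with `t` first yields generators of `I ∩ J`.
[cite: CoxLittleOShea2007, Ch.4 §3 Thm. 11, Lemma 10 (i)] -/
theorem auxVar_span_inf_span_eq_comap (F G : Set (MvPolynomial σ R)) :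
    Ideal.span F ⊓ Ideal.span G =
      (Ideal.span ((fun p => X none * rename some p) '' F ∪
        (fun p => (1 - X none) * rename some p) '' G)).comap
        (rename (some : σ → Option σ) : MvPolynomial σ R →ₐ[R] MvPolynomial (Option σ) R) := by
  rw [auxVar_inf_eq_comap, Ideal.span_union, auxVar_span_singleton_mul_map_span,
    auxVar_span_singleton_mul_map_span]

/-- The notation `(…) ∩ k[x₁, …, xₙ]` of Thm. 11: the image of `L.comap (rename some)` in
`R[x, t]` is literally `L ∩ R[x]`, `R[x]` being the range of the (injective) inclusion
`rename some`. [cite: CoxLittleOShea2007, Ch.4 §3 Thm. 11] -/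
theorem auxVar_image_comap_eq_inter_range (L : Ideal (MvPolynomial (Option σ) R)) :
    (rename (some : σ → Option σ)) '' (L.comap
      (rename (some : σ → Option σ) : MvPolynomial σ R →ₐ[R] MvPolynomial (Option σ) R) : Set _) =
      (L : Set (MvPolynomial (Option σ) R)) ∩
        Set.range (rename (some : σ → Option σ) : MvPolynomial σ R → MvPolynomial (Option σ) R) := by
  rw [Ideal.coe_comap, Set.image_preimage_eq_inter_range]

end AuxVariable

/-! ### Intersections of principal ideals: least common multiples (Def. 12, Prop. 13, Prop. 14) -/

section Principal

/-- **Def. 12 ⇔ Prop. 13 (ii), definition-free**: in any commutative ring, `⟨f⟩ ∩ ⟨g⟩ = ⟨h⟩`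
holds exactly when `h` is a least common multiple of `f` and `g` in the sense of Def. 12
(`f ∣ h`, `g ∣ h`, and `h` divides every common multiple).
[cite: CoxLittleOShea2007, Ch.4 §3 Def. 12, Prop. 13 (ii)] -/
theorem principal_inf_principal_eq_span_iff {R : Type*} [CommRing R] (f g h : R) :
    Ideal.span {f} ⊓ Ideal.span {g} = Ideal.span {h} ↔
      f ∣ h ∧ g ∣ h ∧ ∀ p, f ∣ p → g ∣ p → h ∣ p := by
  constructor
  · intro e
    have hh : h ∈ Ideal.span {f} ⊓ Ideal.span {g} := e ▸ Ideal.mem_span_singleton_self h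
    refine ⟨Ideal.mem_span_singleton.mp hh.1, Ideal.mem_span_singleton.mp hh.2, fun p hf hg => ?_⟩
    have hp : p ∈ Ideal.span {h} :=
      e ▸ (⟨Ideal.mem_span_singleton.mpr hf, Ideal.mem_span_singleton.mpr hg⟩ :
        p ∈ Ideal.span {f} ⊓ Ideal.span {g})
    exact Ideal.mem_span_singleton.mp hp
  · rintro ⟨hf, hg, hmin⟩
    ext p
    simp only [Ideal.mem_inf, Ideal.mem_span_singleton]
    exact ⟨fun hp => hmin p hp.1 hp.2, fun hp => ⟨hf.trans hp, hg.trans hp⟩⟩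

/-- **Prop. 13** in a GCD domain: `⟨a⟩ ∩ ⟨b⟩ = ⟨lcm(a, b)⟩`. (Mathlib's
`Ideal.span_singleton_inf_span_singleton` is the Euclidean-domain case.)
[cite: CoxLittleOShea2007, Ch.4 §3 Prop. 13] -/
theorem principal_inf_principal_eq_span_lcm {R : Type*} [CommRing R] [IsDomain R] [GCDMonoid R]
    (a b : R) : Ideal.span {a} ⊓ Ideal.span {b} = Ideal.span {lcm a b} := by
  ext x
  simp only [Ideal.mem_inf, Ideal.mem_span_singleton]
  exact lcm_dvd_iff.symm

/-- **Prop. 13 (i)** in a unique factorisation domain: the intersection of two principal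
ideals is principal. [cite: CoxLittleOShea2007, Ch.4 §3 Prop. 13 (i)] -/
theorem principal_inf_principal_isPrincipal {R : Type*} [CommRing R] [IsDomain R]
    [UniqueFactorizationMonoid R] (a b : R) :
    (Ideal.span {a} ⊓ Ideal.span {b}).IsPrincipal := by
  letI := UniqueFactorizationMonoid.toGCDMonoid R
  exact ⟨⟨lcm a b, principal_inf_principal_eq_span_lcm a b⟩⟩

/-- **Prop. 13 (i)** for `k[x₁, …, xₙ]` (any index type `σ`): `⟨f⟩ ∩ ⟨g⟩` is principal.
[cite: CoxLittleOShea2007, Ch.4 §3 Prop. 13 (i)] -/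
theorem mvPolynomial_principal_inf_principal_isPrincipal {σ : Type*} {k : Type*} [Field k]
    (f g : MvPolynomial σ k) :
    (Ideal.span {f} ⊓ Ideal.span {g}).IsPrincipal :=
  principal_inf_principal_isPrincipal f g

/-- **Prop. 13 (ii)**: every generator `h` of `⟨f⟩ ∩ ⟨g⟩` is a least common multiple of
`f` and `g` (Def. 12). [cite: CoxLittleOShea2007, Ch.4 §3 Prop. 13 (ii)] -/
theorem dvd_of_principal_inf_principal_eq_span {R : Type*} [CommRing R] {f g h : R}
    (e : Ideal.span {f} ⊓ Ideal.span {g} = Ideal.span {h}) :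
    f ∣ h ∧ g ∣ h ∧ ∀ p, f ∣ p → g ∣ p → h ∣ p :=
  (principal_inf_principal_eq_span_iff f g h).mp e

/-- **Prop. 14** as an equality of ideals: `⟨gcd(f, g) · lcm(f, g)⟩ = ⟨f · g⟩` (Mathlib's
`gcd_mul_lcm` gives the two generators up to a unit). [cite: CoxLittleOShea2007, Ch.4 §3 Prop. 14] -/
theorem span_gcd_mul_lcm_eq_span_mul {R : Type*} [CommRing R] [IsDomain R] [GCDMonoid R]
    (a b : R) : Ideal.span {gcd a b * lcm a b} = Ideal.span {a * b} :=
  Ideal.span_singleton_eq_span_singleton.mpr (gcd_mul_lcm a b)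

end Principal

/-! ### The worked examples of §3 -/

section Examples

/-- For `I = J = ⟨x, y⟩ ⊆ k[x, y]`: `I·J = ⟨x², xy, y²⟩` is strictly contained in `I ∩ J = ⟨x, y⟩`
(any field, indeed any nontrivial commutative ring `k`; the witness `x ∉ I·J` is detected in the
dual numbers `k[ε]`, where `x, y ↦ ε` kills `I·J` but not `x`).
[cite: CoxLittleOShea2007, Ch.4 §3 (example before Lemma 10)] -/
theorem mvPolynomial_span_X_mul_self_lt_inf {k : Type*} [CommRing k] [Nontrivial k] :
    (Ideal.span {X 0, X 1} : Ideal (MvPolynomial (Fin 2) k)) * Ideal.span {X 0, X 1} <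
      Ideal.span {X 0, X 1} ⊓ Ideal.span {X 0, X 1} := by
  refine lt_of_le_of_ne Ideal.mul_le_inf fun e => ?_
  set I : Ideal (MvPolynomial (Fin 2) k) := Ideal.span {X 0, X 1} with hI
  have hx : (X 0 : MvPolynomial (Fin 2) k) ∈ I * I := by
    rw [e, inf_idem]; exact Ideal.subset_span (by simp)
  let φ : MvPolynomial (Fin 2) k →+* DualNumber k :=
    (aeval fun _ : Fin 2 => (DualNumber.eps : DualNumber k) :
      MvPolynomial (Fin 2) k →ₐ[k] DualNumber k).toRingHom
  have hφX : ∀ i : Fin 2, φ (X i) = DualNumber.eps := fun i => by simp [φ]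
  have hφI : I.map φ = Ideal.span {DualNumber.eps} := by
    rw [hI, Ideal.map_span, Set.image_pair, hφX 0, hφX 1, Set.pair_eq_singleton]
  have hbot : (I * I).map φ = ⊥ := by
    rw [Ideal.map_mul, hφI, Ideal.span_singleton_mul_span_singleton, DualNumber.eps_mul_eps,
      Ideal.span_singleton_eq_bot.2 rfl]
  have h0 : (DualNumber.eps : DualNumber k) = 0 := by
    rw [← hφX 0, ← Ideal.mem_bot, ← hbot]
    exact Ideal.mem_map_of_mem φ hx
  have h10 : (1 : k) = 0 := by simpa using congrArg TrivSqZeroExt.snd h0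
  exact one_ne_zero h10

/-- **The worked example following Thm. 11** (certificate produced by the algorithm): for
`I = ⟨x²y⟩`, `J = ⟨xy²⟩ ⊆ k[x, y]`, the polynomial `x²y² = y·(t·x²y) + x·((1 - t)·xy²)` lies in
`t·I + (1 - t)·J ⊆ k[x, y, t]` (it is the `S`-polynomial of the two generators), hence, by Thm. 11,
in `I ∩ J`. [cite: CoxLittleOShea2007, Ch.4 §3 (example following Thm. 11)] -/
theorem mvPolynomial_example_sq_mul_sq_mem_auxVar_sup {k : Type*} [CommRing k] :
    rename (some : Fin 2 → Option (Fin 2)) (X 0 ^ 2 * X 1 ^ 2 : MvPolynomial (Fin 2) k) ∈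
      Ideal.span {X none} *
          (Ideal.span {(X 0 ^ 2 * X 1 : MvPolynomial (Fin 2) k)}).map
            (rename (some : Fin 2 → Option (Fin 2))) ⊔
        Ideal.span {1 - X none} *
          (Ideal.span {(X 0 * X 1 ^ 2 : MvPolynomial (Fin 2) k)}).map
            (rename (some : Fin 2 → Option (Fin 2))) := by
  have hI := Ideal.mul_mem_mul (Ideal.mem_span_singleton_self (X none : MvPolynomial (Option (Fin 2)) k))
    (Ideal.mem_map_of_mem (rename (some : Fin 2 → Option (Fin 2)))
      (Ideal.mem_span_singleton_self (X 0 ^ 2 * X 1 : MvPolynomial (Fin 2) k)))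
  have hJ := Ideal.mul_mem_mul
    (Ideal.mem_span_singleton_self (1 - X none : MvPolynomial (Option (Fin 2)) k))
    (Ideal.mem_map_of_mem (rename (some : Fin 2 → Option (Fin 2)))
      (Ideal.mem_span_singleton_self (X 0 * X 1 ^ 2 : MvPolynomial (Fin 2) k)))
  have e : rename (some : Fin 2 → Option (Fin 2)) (X 0 ^ 2 * X 1 ^ 2 : MvPolynomial (Fin 2) k) =
      X (some 1) * (X none * rename (some : Fin 2 → Option (Fin 2))
        (X 0 ^ 2 * X 1 : MvPolynomial (Fin 2) k)) +
      X (some 0) * ((1 - X none) * rename (some : Fin 2 → Option (Fin 2))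
        (X 0 * X 1 ^ 2 : MvPolynomial (Fin 2) k)) := by
    simp only [map_mul, map_pow, rename_X]
    ring
  rw [e]
  exact Submodule.add_mem_sup (Ideal.mul_mem_left _ _ hI) (Ideal.mul_mem_left _ _ hJ)

/-- **The worked example following Thm. 11 / Def. 12**: in `k[x, y]` (any field `k`),
`⟨x²y⟩ ∩ ⟨xy²⟩ = ⟨x²y²⟩`, i.e. `lcm(x²y, xy²) = x²y²` in the sense of Def. 12.
[cite: CoxLittleOShea2007, Ch.4 §3 (example following Thm. 11), Def. 12 (example)] -/
theorem mvPolynomial_example_span_inf_span_eq_span_lcm {k : Type*} [Field k] :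
    (Ideal.span {(X 0 ^ 2 * X 1 : MvPolynomial (Fin 2) k)}) ⊓ Ideal.span {X 0 * X 1 ^ 2} =
      Ideal.span {X 0 ^ 2 * X 1 ^ 2} := by
  rw [principal_inf_principal_eq_span_iff]
  refine ⟨⟨X 1, by ring⟩, ⟨X 0, by ring⟩, fun p hf hg => ?_⟩
  obtain ⟨a, rfl⟩ := hf
  -- `xy² ∣ x²y·a` forces `y ∣ x·a`, hence (as `y` is prime and does not divide `x`) `y ∣ a`
  have h1 : (X 1 : MvPolynomial (Fin 2) k) ∣ X 0 * a := by
    have e1 : (X 0 * X 1 ^ 2 : MvPolynomial (Fin 2) k) = X 0 * X 1 * X 1 := by ring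
    have e2 : (X 0 ^ 2 * X 1 * a : MvPolynomial (Fin 2) k) = X 0 * X 1 * (X 0 * a) := by ring
    rw [e1, e2] at hg
    exact (mul_dvd_mul_iff_left (mul_ne_zero (X_ne_zero 0) (X_ne_zero 1))).mp hg
  have h2 : (X 1 : MvPolynomial (Fin 2) k) ∣ a := by
    rcases (X_prime (i := (1 : Fin 2)) (R := k)).dvd_or_dvd h1 with h | h
    · exact absurd (X_dvd_X.mp h) (by decide)
    · exact h
  obtain ⟨b, rfl⟩ := h2
  exact ⟨b, by ring⟩

end Examples

end Literature.RingTheory.MvPolynomial.IdealIntersection
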